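import Summits.CriticalPhenomena.PercolationContinuityZ3.Theorems.Transplant.HexShadowUniqueConn
import Summits.CriticalPhenomena.PercolationContinuityZ3.Theorems.Transplant.HexShadowTwoBlock
import HarnessLib

/-!
# The `(111)`-films at their own critical point, MODULO DST's eq. (12) in hexagonal geometry — the end of the gen-31 chain

builds on p205010 (kernel theorem, internal audit signed; external expert review pending) — NOT used in this file.
Lane `prim-bschramm`, seat `prim-bschramm-p2` (gen 31; class C1b; memo `HOME/bschramm/P2-LATTICES.md` §109–§113); helper file
(`--supports stmt-CriticalPhenomena-4575 --as helper`).

For every thickness `k ≥ 1`: the `(111)`-film `F_k = {0 ≤ x₀+x₁+x₂ ≤ k}` of `ℤ³` dies at its own critical point at every vertex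
(`Slab111OwnCriticalContinuity k`, TARGET 2x) AS SOON AS the single node `(Slab111.hexShadow k).Eq12Likely` holds — Duminil-Copin–Sidoravicius–Tassion's
eq. (12) (Lemma 4: square-root trick over the twelve half-sides of the lattice hexagon; Lemma 5; the gluing Lemma 6) in hexagonal geometry.  Everything
else of DST's proof — the interface, eq. (1) from uniqueness (Burton–Keane), (12) ⇒ (13) by the lifted side mirror, (1) ∧ (13) ⇒ the good-edge criterion,
the renormalisation §2.2 (dependent percolation), the assembly — is PROVED in the tree («HexShadowDefs/Transport/Face/FaceCoarse/FaceRenorm/FaceCriterion/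
UniqueConn/TwoBlock», «Slab111HexShadow»).  `k = 1` is unconditional («Slab111Honeycomb»).
[cite: DuminilCopinSidoraviciusTassion2016, Thm. 1 and §2] [cite: BenjaminiSchramm1996, Conj. 4 / Question 3]
-/

noncomputable section

namespace Summit.CriticalPhenomena.PercolationContinuityZ3.Theorems.Transplant

open Literature.Probability.Percolation Literature.Probability.LatticeModels SimpleGraph

/-- **THE `(111)`-FILM THEOREM MODULO DST's EQ. (12)**: `1 ≤ k → (Slab111.hexShadow k).Eq12Likely → Slab111OwnCriticalContinuity k`.  Independent of p205010.
[cite: DuminilCopinSidoraviciusTassion2016, Thm. 1 and §2.1 eq. (12)] [cite: BenjaminiSchramm1996, Conj. 4 / Question 3] -/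
theorem slab111OwnCriticalContinuity_of_eq12Likely {k : ℕ} (hk : 1 ≤ k) (h12 : (Slab111.hexShadow k).Eq12Likely) : Slab111OwnCriticalContinuity k :=
  slab111OwnCriticalContinuity_of_twoBlockLikely hk ((Slab111.hexShadow k).twoBlockLikely_of_eq12Likely h12)

/-- The same for every graph with a hexagonal shadow: a.s. uniqueness at every density, connectedness and eq. (12) give `θ_v(p_c) = 0` at every vertex.
[cite: DuminilCopinSidoraviciusTassion2016, Thm. 1 and §2] -/
theorem HexShadow.theta_criticalProb_eq_zero_of_eq12Likely {V : Type} [Countable V] {G : SimpleGraph V} (Φ : HexShadow G) (hG : G.Connected)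
    (hU : ∀ p : unitInterval, ∀ᵐ ω ∂(bondPercolation G p), numInfiniteClusters ω ≤ 1) (h12 : Φ.Eq12Likely) (v : V) :
    theta G v (criticalProbIOf G v) = 0 :=
  Φ.theta_criticalProb_eq_zero_of_faceNodes
    (Φ.faceGoodEventLikely_of_subnodes (Φ.uniqueConnLikely_of_uniqueness hU) (Φ.twoBlockLikely_of_eq12Likely h12)) (Φ.faceRenormalisation hG) v

end Summit.CriticalPhenomena.PercolationContinuityZ3.Theorems.Transplant

end
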